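/- Width seat 2/3 `ym-line-cbag-p1-w2` (prover-ym-line-cbag-p1-w2-g21-0) of the cell of ideator ym-idea-2, LINE 8
(route `EguchiKawaiDirectionLadder`), post-closure glue for the barrier entry `EguchiKawaiBreakdown` (crux
stmt-QuantumFields-27724, CLOSED·proved): the SHARP constant and the WEIGHT-GENERIC form of "in `d = 2` every open Wilson word of
the Eguchi–Kawai model vanishes at every coupling" (`EguchiKawaiDirectionLadderWilsonWordsTwoDim.lean`).  Route-independent.
HONEST FRAMING: single-site-model theorems; the Yang–Mills mass gap / the summit `YangMills` is NOT proved or advanced. -/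
import Summits.QuantumFields.YangMills.Theorems.EguchiKawaiDirectionLadderWilsonWordsTwoDim
import HarnessLib

/-!
# Open Wilson words in `d = 2`: the sharp constant `⟨|W_l|²⟩ ≤ (wordMult l μ)²/N`, and torus-invariant weights

`EguchiKawaiDirectionLadderWilsonWordsTwoDim.lean` proves `⟨|W_l|²⟩_EK ≤ 2 (wordMult l μ)² / N` in `d = 2` at every coupling.
The factor `2` came from bounding the one-coordinate variances in the Efron–Stein inequality by Jensen.  Here:

* `FiniteAveraging.sum_sum_update_eq` (re-randomising one coordinate: `Σ_m Σ_a g(m[c↦a]) = |α| Σ_m g m`),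
  `FiniteAveraging.sum_sum_norm_sub_sq_eq` (the exact one-variable identity `Σ_a Σ_b ‖u_b − u_a‖² = 2|α| Σ_a ‖u_a − ū‖²`) and
  `FiniteAveraging.sum_norm_sq_le_of_sum_eq_zero_sharp`: `Σ F = 0 ⇒ Σ_m ‖F m‖² ≤ (2|α|)⁻¹ Σ_c Σ_m Σ_a ‖F(m[c↦a]) − F m‖²`
  (the exact Efron–Stein constant);
* `sum_normSq_wordTrace_le_sharp`: `Σ_m |tr W_l(A, P·diag(ζ(m))·P⁻¹·V)|² ≤ N (wordMult l 1)² M^N`;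
* `integral_mul_normSq_wordTrace_le_of_torusInvariant` — **weight-generic transfer**: for ANY `A, P ∈ U(N)` and any continuous
  weight `w ≥ 0` on the second link invariant under left multiplication by the conjugate torus `P·diag(z)·P⁻¹`,
  `∫ w |tr W_l(A,V)|² dV ≤ N (wordMult l 1)² ∫ w dV` whenever `wordCharge l 1 ≠ 0` (so every torus-invariant two-dimensional
  single-site weight — Wilson, and e.g. plaquette-determined ones once their invariance is checked — has vanishing open words);
* `ekExpectation_le_of_pair_le` — Fubini transfer: a first-link-wise bound `∫_V |W_l|² w ≤ C ∫_V w` gives `⟨|W_l|²⟩_EK ≤ C`;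
* `ekExpectation_normSq_ekWord_two_le_sharp`: **`⟨|W_l|²⟩_EK ≤ (wordMult l μ)² / N`** (`d = 2`, every `b`, `N ≥ 1`,
  `wordCharge l μ ≠ 0`), which for the one-letter word `[(μ, +)]` (`ekWord_single`, `wordMult = 1`) is literally the landed
  `ekOrderParameter_two_le : ekOrderParameter 2 N b μ ≤ 1/N` (checked: the gate's dedup identifies the specialisation with it).

References: Y. Makeenko, *Methods of Contemporary Gauge Theory* (CUP 2023) §14.3–§14.4; B. Efron, C. Stein, Ann. Statist. 9
(1981) 586–596.
-/

set_option autoImplicit false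

noncomputable section

open scoped Matrix ComplexConjugate BigOperators RealInnerProductSpace
open Matrix Complex MeasureTheory Filter Topology
open Literature.Barriers.QuantumFields
open Literature.LinearAlgebra.Matrix (diagonalTorus mem_diagonalTorus_iff exists_conj_mem_diagonalTorus
  mul_comm_of_mem_diagonalTorus diagonalTorusHom coe_diagonalTorusHom_apply)

namespace Summit.QuantumFields.YangMills.Theorems.EguchiKawaiDirectionLadder

/-! ### §1  The exact Efron–Stein constant -/

namespace FiniteAveraging

/-- **Re-randomising one coordinate**: `Σ_m Σ_a g(m[c ↦ a]) = |α| • Σ_m g m` (the map `(m, a) ↦ (m[c ↦ a], m_c)` is an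
involution of `(Fin N → α) × α`). -/
theorem sum_sum_update_eq {α : Type*} [Fintype α] [DecidableEq α] {N : ℕ} {β : Type*} [AddCommMonoid β]
    (g : (Fin N → α) → β) (c : Fin N) :
    ∑ m : Fin N → α, ∑ a : α, g (Function.update m c a) = Fintype.card α • ∑ m, g m := by
  set Φ : (Fin N → α) × α → (Fin N → α) × α := fun p => (Function.update p.1 c p.2, p.1 c) with hΦ
  have hinv : Function.Involutive Φ := by
    rintro ⟨m, a⟩
    simp [hΦ]
  calc ∑ m : Fin N → α, ∑ a : α, g (Function.update m c a) = ∑ p : (Fin N → α) × α, g (Φ p).1 := by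
        rw [Fintype.sum_prod_type]
    _ = ∑ p : (Fin N → α) × α, g p.1 :=
        Fintype.sum_equiv (hinv.toPerm Φ) (fun p => g (Φ p).1) (fun p => g p.1) fun p => rfl
    _ = Fintype.card α • ∑ m, g m := by
        rw [Fintype.sum_prod_type, Finset.smul_sum]
        exact Finset.sum_congr rfl fun m _ => by simp

variable {E : Type*} [NormedAddCommGroup E] [InnerProductSpace ℝ E]

/-- Centred form of the one-variable identity: if `Σ_a v_a = 0` then `Σ_a Σ_b ‖v_b − v_a‖² = 2|α| · Σ_a ‖v_a‖²`. -/
theorem sum_sum_norm_sub_sq_eq_of_sum_eq_zero {α : Type*} [Fintype α] (v : α → E) (hv : ∑ a, v a = 0) :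
    ∑ a, ∑ b, ‖v b - v a‖ ^ 2 = 2 * (Fintype.card α : ℝ) * ∑ a, ‖v a‖ ^ 2 := by
  simp only [norm_sub_sq_real]
  simp_rw [Finset.sum_add_distrib, Finset.sum_sub_distrib, ← Finset.mul_sum, ← sum_inner, hv, inner_zero_left,
    Finset.sum_const_zero, mul_zero, sub_zero, Finset.sum_const, Finset.card_univ, nsmul_eq_mul, ← Finset.mul_sum]
  ring

/-- **The exact one-variable variance identity**: `Σ_a Σ_b ‖u_b − u_a‖² = 2|α| · Σ_a ‖u_a − |α|⁻¹ Σ_b u_b‖²`. -/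
theorem sum_sum_norm_sub_sq_eq {α : Type*} [Fintype α] [Nonempty α] (u : α → E) :
    ∑ a, ∑ b, ‖u b - u a‖ ^ 2 = 2 * (Fintype.card α : ℝ) * ∑ a, ‖u a - (Fintype.card α : ℝ)⁻¹ • ∑ b, u b‖ ^ 2 := by
  set ū : E := (Fintype.card α : ℝ)⁻¹ • ∑ b, u b with hū
  have h0 : ∑ a, (u a - ū) = 0 := sum_sub_mean_eq_zero u
  have h := sum_sum_norm_sub_sq_eq_of_sum_eq_zero (fun a => u a - ū) h0
  simp only [sub_sub_sub_cancel_right] at h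
  exact h

/-- **Efron–Stein with the exact constant**: if `Σ_m F m = 0` then
`Σ_m ‖F m‖² ≤ (2|α|)⁻¹ · Σ_c Σ_m Σ_a ‖F(m[c ↦ a]) − F m‖²` (the one-coordinate variances written exactly as half the mean squared
increment, instead of the Jensen bound of `sum_norm_sq_le_of_sum_eq_zero`). -/
theorem sum_norm_sq_le_of_sum_eq_zero_sharp {α : Type*} [Fintype α] [Nonempty α] [DecidableEq α] {N : ℕ}
    (F : (Fin N → α) → E) (h0 : ∑ m, F m = 0) :
    ∑ m, ‖F m‖ ^ 2 ≤
      (2 * (Fintype.card α : ℝ))⁻¹ * ∑ c : Fin N, ∑ m, ∑ a, ‖F (Function.update m c a) - F m‖ ^ 2 := by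
  have h := sum_norm_sub_mean_sq_le_sum_coord N F
  simp only [h0, smul_zero, sub_zero] at h
  refine h.trans (le_of_eq ?_)
  rw [Finset.mul_sum]
  refine Finset.sum_congr rfl fun c _ => ?_
  have hcard : (Fintype.card α : ℝ) ≠ 0 := Nat.cast_ne_zero.2 Fintype.card_ne_zero
  -- both sides, multiplied by `|α|`, are re-randomised sums over the coordinate `c`
  have hL := sum_sum_update_eq
    (fun m => ‖F m - (Fintype.card α : ℝ)⁻¹ • ∑ a, F (Function.update m c a)‖ ^ 2) c
  have hR := sum_sum_update_eq (fun m => ∑ a, ‖F (Function.update m c a) - F m‖ ^ 2) c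
  simp only [Function.update_idem, nsmul_eq_mul] at hL hR
  -- the exact identity on each fibre
  have hfib : ∀ m : Fin N → α,
      ∑ a', ∑ a, ‖F (Function.update m c a) - F (Function.update m c a')‖ ^ 2 =
        2 * (Fintype.card α : ℝ) *
          ∑ a', ‖F (Function.update m c a') - (Fintype.card α : ℝ)⁻¹ • ∑ a, F (Function.update m c a)‖ ^ 2 :=
    fun m => sum_sum_norm_sub_sq_eq (fun a => F (Function.update m c a))
  have key : (Fintype.card α : ℝ) * ∑ m, ∑ a, ‖F (Function.update m c a) - F m‖ ^ 2 =
      2 * (Fintype.card α : ℝ) *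
        ((Fintype.card α : ℝ) * ∑ m, ‖F m - (Fintype.card α : ℝ)⁻¹ • ∑ a, F (Function.update m c a)‖ ^ 2) := by
    rw [← hR, ← hL, Finset.mul_sum]
    exact Finset.sum_congr rfl fun m _ => hfib m
  have h2 : (2 * (Fintype.card α : ℝ)) ≠ 0 := mul_ne_zero two_ne_zero hcard
  have key' : ∑ m, ∑ a, ‖F (Function.update m c a) - F m‖ ^ 2 =
      2 * (Fintype.card α : ℝ) * ∑ m, ‖F m - (Fintype.card α : ℝ)⁻¹ • ∑ a, F (Function.update m c a)‖ ^ 2 := by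
    refine mul_left_cancel₀ hcard ?_
    rw [key]
    ring
  rw [key', ← mul_assoc, inv_mul_cancel₀ h2, one_mul]

end FiniteAveraging

variable {N : ℕ}

/-! ### §2  The sharp finite-torus bound -/

section Torus

variable {M : ℕ} [NeZero M]

/-- **The finite-torus bound with the sharp constant**: `Σ_m |tr W_l(A, P·diag(ζ(m))·P⁻¹·V)|² ≤ N (wordMult l 1)² · M^N`
when `M ∤ q`, `M ≥ 2` (as `sum_normSq_wordTrace_le`, with `sum_norm_sq_le_of_sum_eq_zero_sharp`). -/
theorem sum_normSq_wordTrace_le_sharp (hM : 2 ≤ M) (P A V : UN N) {l : List (Fin 2 × Bool)}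
    (hq : ¬ ((M : ℤ) ∣ wordCharge l 1)) :
    ∑ m : Fin N → ZMod M, ‖(ekWordMatrix l
        (![A, P * diagonalTorusHom (Fin N) (fun i => ZMod.toCircle (m i)) * P⁻¹ * V] : EKConfig 2 N)).trace‖ ^ 2 ≤
      N * (wordMult l 1 : ℝ) ^ 2 * Fintype.card (Fin N → ZMod M) := by
  set F : (Fin N → ZMod M) → ℂ := fun m => (ekWordMatrix l
      (![A, P * diagonalTorusHom (Fin N) (fun i => ZMod.toCircle (m i)) * P⁻¹ * V] : EKConfig 2 N)).trace with hF
  have h0 : ∑ m, F m = 0 := sum_wordTrace_eq_zero P A V hq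
  have hES := FiniteAveraging.sum_norm_sq_le_of_sum_eq_zero_sharp (E := ℂ) F h0
  have hMpos : (0 : ℝ) < M := by exact_mod_cast (show 0 < M by omega)
  have hcoord : ∀ (c : Fin N) (m : Fin N → ZMod M),
      ∑ a, ‖F (Function.update m c a) - F m‖ ^ 2 ≤ (wordMult l 1 : ℝ) ^ 2 * (2 * M) := by
    intro c m
    rw [← sum_norm_toCircle_sub_sq hM (m c), Finset.mul_sum]
    refine Finset.sum_le_sum fun a _ => ?_
    rw [← mul_pow]
    exact pow_le_pow_left₀ (norm_nonneg _) (norm_wordTrace_update_sub_le P A V l m c a) 2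
  calc ∑ m, ‖F m‖ ^ 2
      ≤ (2 * (Fintype.card (ZMod M) : ℝ))⁻¹ * ∑ c : Fin N, ∑ m, ∑ a, ‖F (Function.update m c a) - F m‖ ^ 2 := hES
    _ ≤ (2 * (Fintype.card (ZMod M) : ℝ))⁻¹ *
          ∑ _c : Fin N, ∑ _m : Fin N → ZMod M, (wordMult l 1 : ℝ) ^ 2 * (2 * M) :=
        mul_le_mul_of_nonneg_left (Finset.sum_le_sum fun c _ => Finset.sum_le_sum fun m _ => hcoord c m)
          (by positivity)
    _ = N * (wordMult l 1 : ℝ) ^ 2 * Fintype.card (Fin N → ZMod M) := by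
        have hM0 : (2 * (M : ℝ)) ≠ 0 := by positivity
        rw [ZMod.card, Finset.sum_const, Finset.sum_const, Finset.card_univ, Finset.card_univ, Fintype.card_fin]
        simp only [nsmul_eq_mul]
        rw [inv_mul_eq_div, div_eq_iff hM0]
        ring

end Torus

/-! ### §3  Weight-generic transfer to the Haar integral -/

/-- **Vanishing of open words for ANY torus-invariant weight (fixed first link).**  Let `A, P ∈ U(N)` be arbitrary and let
`w ≥ 0` be a continuous weight on the second link, invariant under left multiplication by the conjugate torus
`P·diag(z)·P⁻¹`, `z ∈ U(1)^N`.  Then for every word with non-zero winding in the second direction,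
`∫ w(V) |tr W_l(A,V)|² dV ≤ N (wordMult l 1)² ∫ w(V) dV`.  (For the Eguchi–Kawai weight take `P` diagonalising `A`,
`integral_ekWeight_pair_mul_normSq_wordTrace_le_sharp`; other two-dimensional single-site weights only need their invariance.) -/
theorem integral_mul_normSq_wordTrace_le_of_torusInvariant (P A : UN N) {w : UN N → ℝ} (hwc : Continuous w)
    (hw0 : ∀ V, 0 ≤ w V) (hw : ∀ (z : Fin N → Circle) (V : UN N), w (P * diagonalTorusHom (Fin N) z * P⁻¹ * V) = w V)
    {l : List (Fin 2 × Bool)} (hq : wordCharge l 1 ≠ 0) :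
    ∫ V, w V * ‖(ekWordMatrix l (![A, V] : EKConfig 2 N)).trace‖ ^ 2 ∂haarUN N ≤
      (N * (wordMult l 1 : ℝ) ^ 2) * ∫ V, w V ∂haarUN N := by
  -- the modulus of the finite torus: `M = |q| + 1 ∤ q`, `M ≥ 2`
  obtain ⟨M, hM2, hMq⟩ : ∃ M : ℕ, 2 ≤ M ∧ ¬ ((M : ℤ) ∣ wordCharge l 1) := by
    refine ⟨(wordCharge l 1).natAbs + 1, ?_, ?_⟩
    · have : (wordCharge l 1).natAbs ≠ 0 := Int.natAbs_ne_zero.2 hq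
      omega
    · intro hdvd
      refine hq (Int.eq_zero_of_dvd_of_natAbs_lt_natAbs hdvd ?_)
      rw [Int.natAbs_natCast]
      exact Nat.lt_succ_self _
  haveI : NeZero M := ⟨by omega⟩
  set T : (Fin N → ZMod M) → UN N := fun m => P * diagonalTorusHom (Fin N) (fun i => ZMod.toCircle (m i)) * P⁻¹
    with hT
  set G : (Fin N → ZMod M) → UN N → ℝ := fun m V =>
    w V * ‖(ekWordMatrix l (![A, T m * V] : EKConfig 2 N)).trace‖ ^ 2 with hG
  have hGc : ∀ m, Continuous (G m) := fun m => hwc.mul ((continuous_wordTrace_pair A (T m) l).norm.pow 2)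
  -- (1) invariance: the integral equals the integral of the rotated word, for every `m`
  have hinv : ∀ m, ∫ V, w V * ‖(ekWordMatrix l (![A, V] : EKConfig 2 N)).trace‖ ^ 2 ∂haarUN N =
      ∫ V, G m V ∂haarUN N := by
    intro m
    have hmp : MeasurePreserving (fun V : UN N => T m * V) (haarUN N) (haarUN N) := measurePreserving_mul_left _ _
    have hemb : MeasurableEmbedding (fun V : UN N => T m * V) := (MeasurableEquiv.mulLeft (T m)).measurableEmbedding
    calc ∫ V, w V * ‖(ekWordMatrix l (![A, V] : EKConfig 2 N)).trace‖ ^ 2 ∂haarUN N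
        = ∫ V, w (T m * V) * ‖(ekWordMatrix l (![A, T m * V] : EKConfig 2 N)).trace‖ ^ 2 ∂haarUN N := by
          rw [← hmp.integral_comp hemb]
      _ = ∫ V, G m V ∂haarUN N := by
          refine integral_congr_ae (Eventually.of_forall fun V => ?_)
          simp only [hG, hT, hw]
  -- (2) sum over the finite torus and use the sharp pointwise bound
  have hcard : (0 : ℝ) < Fintype.card (Fin N → ZMod M) := Nat.cast_pos.2 Fintype.card_pos
  have hsum : (Fintype.card (Fin N → ZMod M) : ℝ) *
      ∫ V, w V * ‖(ekWordMatrix l (![A, V] : EKConfig 2 N)).trace‖ ^ 2 ∂haarUN N =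
        ∫ V, ∑ m, G m V ∂haarUN N := by
    rw [integral_finsetSum _ (fun m _ => integrable_of_continuous (hGc m))]
    simp_rw [← hinv]
    rw [Finset.sum_const, Finset.card_univ, nsmul_eq_mul]
  have hpt : ∀ V, ∑ m, G m V ≤ w V * (N * (wordMult l 1 : ℝ) ^ 2 * Fintype.card (Fin N → ZMod M)) := by
    intro V
    simp only [hG]
    rw [← Finset.mul_sum]
    exact mul_le_mul_of_nonneg_left (sum_normSq_wordTrace_le_sharp hM2 P A V hMq) (hw0 V)
  have hle : ∫ V, ∑ m, G m V ∂haarUN N ≤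
      ∫ V, w V * (N * (wordMult l 1 : ℝ) ^ 2 * Fintype.card (Fin N → ZMod M)) ∂haarUN N :=
    integral_mono (integrable_finsetSum _ (fun m _ => integrable_of_continuous (hGc m)))
      ((integrable_of_continuous hwc).mul_const _) hpt
  rw [integral_mul_const] at hle
  have key : (Fintype.card (Fin N → ZMod M) : ℝ) *
      ∫ V, w V * ‖(ekWordMatrix l (![A, V] : EKConfig 2 N)).trace‖ ^ 2 ∂haarUN N ≤
        (Fintype.card (Fin N → ZMod M) : ℝ) * ((N * (wordMult l 1 : ℝ) ^ 2) * ∫ V, w V ∂haarUN N) := by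
    rw [hsum]
    refine hle.trans (le_of_eq ?_)
    ring
  exact le_of_mul_le_mul_left key hcard

/-- **The one-link inequality for the Eguchi–Kawai weight, sharp constant**: for every `A ∈ U(N)`, `b ∈ ℝ` and every word with
non-zero winding in the second direction, `∫ e^{−N²bS_R[A,V]} |tr W_l(A,V)|² dV ≤ N (wordMult l 1)² ∫ e^{−N²bS_R[A,V]} dV`. -/
theorem integral_ekWeight_pair_mul_normSq_wordTrace_le_sharp (b : ℝ) (A : UN N) {l : List (Fin 2 × Bool)}
    (hq : wordCharge l 1 ≠ 0) :
    ∫ V, ekWeight N b (![A, V] : EKConfig 2 N) * ‖(ekWordMatrix l (![A, V] : EKConfig 2 N)).trace‖ ^ 2 ∂haarUN N ≤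
      (N * (wordMult l 1 : ℝ) ^ 2) * ∫ V, ekWeight N b (![A, V] : EKConfig 2 N) ∂haarUN N := by
  obtain ⟨P, hP⟩ := exists_conj_mem_diagonalTorus A
  exact integral_mul_normSq_wordTrace_le_of_torusInvariant P A (TwoDim.continuous_ekWeight_pair b A)
    (fun V => (Real.exp_pos _).le) (fun z V => TwoDim.ekWeight_pair_mul_left b A V _ (conj_torus_mul_comm hP z)) hq

/-! ### §4  Fubini transfer and the sharp headline statements -/

/-- **Fubini transfer.**  A first-link-wise bound `∫_V |W_l(A,V)|² e^{−N²bS_R[A,V]} dV ≤ C ∫_V e^{−N²bS_R[A,V]} dV` for every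
`A` gives `⟨|W_l|²⟩_EK ≤ C` in the `d = 2` model. -/
theorem ekExpectation_le_of_pair_le (b C : ℝ) (l : List (Fin 2 × Bool))
    (h : ∀ A : UN N, ∫ V, ‖ekWord l (![A, V] : EKConfig 2 N)‖ ^ 2 * ekWeight N b (![A, V] : EKConfig 2 N) ∂haarUN N ≤
      C * ∫ V, ekWeight N b (![A, V] : EKConfig 2 N) ∂haarUN N) :
    ekExpectation N b (fun U : EKConfig 2 N => ‖ekWord l U‖ ^ 2) ≤ C := by
  unfold ekExpectation
  rw [div_le_iff₀ (ekPartition_pos 2 N b)]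
  have hc₁ : Continuous fun U : EKConfig 2 N => ‖ekWord l U‖ ^ 2 * ekWeight N b U :=
    ((continuous_ekWord (d := 2) (N := N) l).norm.pow 2).mul (continuous_ekWeight (d := 2) N b)
  have hc₂ : Continuous fun U : EKConfig 2 N => ekWeight N b U := continuous_ekWeight (d := 2) N b
  have h1 := TwoDim.integral_ekHaar_two (fun U : EKConfig 2 N => ‖ekWord l U‖ ^ 2 * ekWeight N b U) hc₁
  have h2 := TwoDim.integral_ekHaar_two (fun U : EKConfig 2 N => ekWeight N b U) hc₂
  have hf := TwoDim.integrable_integral_pair (fun U : EKConfig 2 N => ‖ekWord l U‖ ^ 2 * ekWeight N b U) hc₁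
  have hg := (TwoDim.integrable_integral_pair (fun U : EKConfig 2 N => ekWeight N b U) hc₂).const_mul C
  have hfg := integral_mono hf hg h
  have h3 := integral_const_mul (μ := haarUN N) C
    (fun A : UN N => ∫ V, ekWeight N b (![A, V] : EKConfig 2 N) ∂haarUN N)
  calc ∫ U, ‖ekWord l U‖ ^ 2 * ekWeight N b U ∂ekHaar 2 N
      = ∫ A, (∫ V, ‖ekWord l (![A, V] : EKConfig 2 N)‖ ^ 2 * ekWeight N b (![A, V] : EKConfig 2 N) ∂haarUN N)
          ∂haarUN N := h1
    _ ≤ ∫ A, C * (∫ V, ekWeight N b (![A, V] : EKConfig 2 N) ∂haarUN N) ∂haarUN N := hfg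
    _ = C * ∫ A, (∫ V, ekWeight N b (![A, V] : EKConfig 2 N) ∂haarUN N) ∂haarUN N := h3
    _ = C * ∫ U, ekWeight N b U ∂ekHaar 2 N := congrArg (fun z : ℝ => C * z) h2.symm

/-- The sharp pointwise (first-link) inequality for the normalised word:
`∫ |W_l(A,V)|² e^{−N²bS_R[A,V]} dV ≤ ((wordMult l 1)²/N) ∫ e^{−N²bS_R[A,V]} dV`. -/
theorem integral_pair_normSq_ekWord_le_sharp (hN : 0 < N) (b : ℝ) (A : UN N) {l : List (Fin 2 × Bool)}
    (hq : wordCharge l 1 ≠ 0) :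
    ∫ V, ‖ekWord l (![A, V] : EKConfig 2 N)‖ ^ 2 * ekWeight N b (![A, V] : EKConfig 2 N) ∂haarUN N ≤
      ((wordMult l 1 : ℝ) ^ 2 / N) * ∫ V, ekWeight N b (![A, V] : EKConfig 2 N) ∂haarUN N := by
  have hN' : (0 : ℝ) < N := Nat.cast_pos.2 hN
  have hsq : ∀ V : UN N, ‖ekWord l (![A, V] : EKConfig 2 N)‖ ^ 2 * ekWeight N b (![A, V] : EKConfig 2 N) =
      (1 / (N : ℝ) ^ 2) * (ekWeight N b (![A, V] : EKConfig 2 N) *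
        ‖(ekWordMatrix l (![A, V] : EKConfig 2 N)).trace‖ ^ 2) := by
    intro V
    rw [ekWord, norm_div, Complex.norm_natCast, div_pow]
    ring
  simp_rw [hsq]
  rw [integral_const_mul]
  calc 1 / (N : ℝ) ^ 2 * ∫ V, ekWeight N b (![A, V] : EKConfig 2 N) *
          ‖(ekWordMatrix l (![A, V] : EKConfig 2 N)).trace‖ ^ 2 ∂haarUN N
      ≤ 1 / (N : ℝ) ^ 2 * ((N * (wordMult l 1 : ℝ) ^ 2) * ∫ V, ekWeight N b (![A, V] : EKConfig 2 N) ∂haarUN N) :=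
        mul_le_mul_of_nonneg_left (integral_ekWeight_pair_mul_normSq_wordTrace_le_sharp b A hq) (by positivity)
    _ = ((wordMult l 1 : ℝ) ^ 2 / N) * ∫ V, ekWeight N b (![A, V] : EKConfig 2 N) ∂haarUN N := by
        rw [← mul_assoc]
        congr 1
        field_simp

/-- **The sharp bound: in `d = 2`, `⟨|W_l|²⟩_EK ≤ (wordMult l μ)² / N` at every coupling** (`b ∈ ℝ`, `N ≥ 1`,
`wordCharge l μ ≠ 0`).  For the one-letter word `[(μ, +)]` this is `1/N`, the constant of `ekOrderParameter_two_le`. -/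
theorem ekExpectation_normSq_ekWord_two_le_sharp (hN : 0 < N) (b : ℝ) {l : List (Fin 2 × Bool)} {μ : Fin 2}
    (hq : wordCharge l μ ≠ 0) :
    ekExpectation N b (fun U : EKConfig 2 N => ‖ekWord l U‖ ^ 2) ≤ (wordMult l μ : ℝ) ^ 2 / N := by
  rcases Fin.eq_zero_or_eq_succ μ with rfl | ⟨j, rfl⟩
  · set σ : Equiv.Perm (Fin 2) := Equiv.swap 0 1 with hσ
    have hσ0 : σ 0 = 1 := by rw [hσ, Equiv.swap_apply_left]
    rw [ekExpectation_normSq_ekWord_relabel b σ l]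
    have hq' : wordCharge (l.map fun a => (σ a.1, a.2)) 1 ≠ 0 := by rwa [← hσ0, wordCharge_map_relabel]
    have hm : wordMult (l.map fun a => (σ a.1, a.2)) 1 = wordMult l 0 := by rw [← hσ0, wordMult_map_relabel]
    have h := ekExpectation_le_of_pair_le b _ _ fun A => integral_pair_normSq_ekWord_le_sharp hN b A hq'
    rwa [hm] at h
  · have hj : j = 0 := Fin.eq_zero j
    subst hj
    exact ekExpectation_le_of_pair_le b _ _ fun A => integral_pair_normSq_ekWord_le_sharp hN b A hq

/-- The same for the gauge group `SU(N)`. -/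
theorem ekExpectationSU_normSq_ekWord_two_le_sharp (hN : 0 < N) (b : ℝ) {l : List (Fin 2 × Bool)} {μ : Fin 2}
    (hq : wordCharge l μ ≠ 0) :
    ekExpectationSU N b (fun V : EKConfigSU 2 N => ‖ekWord l (inclSU V)‖ ^ 2) ≤ (wordMult l μ : ℝ) ^ 2 / N := by
  rw [← ekExpectation_normSq_ekWord_eq]
  exact ekExpectation_normSq_ekWord_two_le_sharp hN b hq

end Summit.QuantumFields.YangMills.Theorems.EguchiKawaiDirectionLadder

end
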